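import Literature.AlgebraicGeometry.Modules.UnitCocyclePullback
import Mathlib.AlgebraicGeometry.AffineScheme
import HarnessLib

/-!
# Čech `1`-cocycles of units presented along a morphism of schemes

Continuation of `Modules/UnitCocycle.lean` and `Modules/UnitCocyclePullback.lean`. For a morphism of
schemes `ι : Y ⟶ X` (the case in view is a closed immersion `X_n ↪ 𝒳` of a member of a tower of
nilpotent thickenings), a *presentation datum* consists of opens `A : S → X.Opens` indexed by an
auxiliary type `S`, a map `π : Y → S` with `ι y ∈ A (π y)`, and sections `G_{ab} ∈ Γ(X, A_a ⊓ A_b)`.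
It *presents* a cocycle `g` on `Y` when `U_y = ι⁻¹ A_{π y}` and `g_{yy'} = ι^♯(G_{π y, π y'})`
(these two conditions are spelled out as hypotheses `hU`, `hg` below; there are no new definitions).

* `UnitCocycle.exists_presented` — a datum satisfying the cocycle identity modulo `ker ι^♯`, with
  `ι^♯(G_{aa})` units, presents a cocycle on `Y`;
* `CechPic.mk_eq_mk_of_presented`, `CechPic.mk_eq_mk_of_presented_congr` — the presented class only
  depends on `ι^♯` of the datum, on any refinement;
* `CechPic.mk_presented_mul`, `CechPic.mk_presented_pow`, `CechPic.exists_presented_pow` — products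
  and powers;
* `CechPic.pullback_mk_presented` — for `ι = t ≫ ι'`, pulling back along `t` a class presented along
  `ι'` gives the class presented along `ι` by the same datum; `CechPic.pullback_comp` —
  functoriality `(f ≫ g)^* = f^* ∘ g^*` of `CechPic.pullback`;
* `CechPic.exists_presentation` — if `ι` is a topological embedding, surjective on sections over
  affine opens, and intersections of affine opens of `X` are affine (e.g. a closed immersion into a scheme
  separated over an affine base), every class on `Y` is presented by a datum on affine opens of `X`,
  together with `ι^♯`-inverses `H_{ab}` of the `G_{ab}`.

This is the bookkeeping of Čech cocycles "with values in `𝒪_X` read modulo an ideal" behind the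
obstruction theory for lifting line bundles along nilpotent thickenings
(`Modules/UnitCocycleTowerLift.lean`); Hartshorne III §4 and Ex. III.4.4–4.6. Everything is proved;
no named facts; no definitions.

## References

* R. Hartshorne, *Algebraic Geometry*, GTM 52 (1977), III §4, Ex. III.4.4–4.6. [Hartshorne1977]
-/

noncomputable section

open CategoryTheory AlgebraicGeometry Opposite TopologicalSpace

namespace Literature.AlgebraicGeometry.Modules

universe u v

variable {X Y Y' Z : Scheme.{u}}

/-! ### Restriction bookkeeping for `Scheme.Hom.appLE` -/

/-- `ι^♯` over `V` of a restricted section is `ι^♯` over `V` of the section. [folklore] -/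
theorem appLE_secRes (ι : Y ⟶ X) {U U' : X.Opens} (i : U' ≤ U) {V : Y.Opens} (e : V ≤ ι ⁻¹ᵁ U')
    (s : Γ(X, U)) :
    ι.appLE U' V e (secRes X i s) = ι.appLE U V (e.trans (ι.preimage_mono i)) s := by
  change (X.presheaf.map (homOfLE i).op ≫ ι.appLE U' V e) s = _
  rw [Scheme.Hom.map_appLE]

/-- Restricting `ι^♯(s)|_V` further to `V' ≤ V` gives `ι^♯(s)|_{V'}`. [folklore] -/
theorem secRes_appLE (ι : Y ⟶ X) {U : X.Opens} {V V' : Y.Opens} (e : V ≤ ι ⁻¹ᵁ U) (j : V' ≤ V)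
    (s : Γ(X, U)) : secRes Y j (ι.appLE U V e s) = ι.appLE U V' (j.trans e) s := by
  change (ι.appLE U V e ≫ Y.presheaf.map (homOfLE j).op) s = _
  rw [Scheme.Hom.appLE_map]

/-- Naturality of `ι^♯` with respect to restriction: `ι^♯(s|_{U'}) = ι^♯(s)|_{ι⁻¹U'}`. [folklore] -/
theorem app_secRes (ι : Y ⟶ X) {U U' : X.Opens} (i : U' ≤ U) (s : Γ(X, U)) :
    ι.app U' (secRes X i s) = secRes Y (ι.preimage_mono i) (ι.app U s) := by
  rw [Scheme.Hom.app_eq_appLE ι (U := U'), appLE_secRes, Scheme.Hom.app_eq_appLE ι (U := U),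
    secRes_appLE]

/-- `ι^♯` over `V` factors through `ι^♯ : Γ(X, U) → Γ(Y, ι⁻¹U)`: equal images under `ι^♯` have
equal images over every `V ≤ ι⁻¹ U`. [folklore] -/
theorem appLE_eq_of_app_eq (ι : Y ⟶ X) {U : X.Opens} {V : Y.Opens} (e : V ≤ ι ⁻¹ᵁ U)
    {s s' : Γ(X, U)} (h : ι.app U s = ι.app U s') : ι.appLE U V e s = ι.appLE U V e s' := by
  change (ι.app U ≫ Y.presheaf.map _) s = (ι.app U ≫ Y.presheaf.map _) s'
  rw [CommRingCat.comp_apply, CommRingCat.comp_apply, h]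

/-- The composite of `ι'^♯` over `W` and `t^♯` over `V` is `(t ≫ ι')^♯` over `V`. [folklore] -/
theorem appLE_appLE (t : Y ⟶ Y') (ι' : Y' ⟶ X) {U : X.Opens} {W : Y'.Opens} {V : Y.Opens}
    (e₁ : W ≤ ι' ⁻¹ᵁ U) (e₂ : V ≤ t ⁻¹ᵁ W) (s : Γ(X, U)) :
    t.appLE W V e₂ (ι'.appLE U W e₁ s) = (t ≫ ι').appLE U V (e₂.trans (t.preimage_mono e₁)) s := by
  change (ι'.appLE U W e₁ ≫ t.appLE W V e₂) s = _
  rw [Scheme.Hom.appLE_comp_appLE]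

/-- `ι^♯(G_{ab})` over `V` only depends on the indices `a`, `b` up to equality. [folklore] -/
theorem appLE_congr_index (ι : Y ⟶ X) {S : Type v} (A : S → X.Opens)
    (G : ∀ a b : S, Γ(X, A a ⊓ A b)) {a a' b b' : S} (ha : a = a') (hb : b = b') {V : Y.Opens}
    (e : V ≤ ι ⁻¹ᵁ (A a ⊓ A b)) (e' : V ≤ ι ⁻¹ᵁ (A a' ⊓ A b')) :
    ι.appLE (A a ⊓ A b) V e (G a b) = ι.appLE (A a' ⊓ A b') V e' (G a' b') := by
  subst ha hb; rfl

namespace UnitCocycle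

/-- The transition functions of a cocycle only depend on the points up to equality. [folklore] -/
theorem g_congr (c : UnitCocycle X) {x x' y y' : X} (hx : x = x') (hy : y = y') (V : X.Opens)
    (hV : V ≤ c.U x) (hV' : V ≤ c.U y) (hW : V ≤ c.U x') (hW' : V ≤ c.U y') :
    c.g x y V hV hV' = c.g x' y' V hW hW' := by
  subst hx hy; rfl

/-- The transition functions of a pulled-back cocycle (definitional unfolding). [folklore] -/
theorem pullback_g (f : X ⟶ Y) (c : UnitCocycle Y) (x y : X) (V : X.Opens)
    (hx : V ≤ (pullback f c).U x) (hy : V ≤ (pullback f c).U y) :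
    (pullback f c).g x y V hx hy = f.appLE (c.U (f.base x) ⊓ c.U (f.base y)) V
      (le_preimage_inf f hx hy) (c.g (f.base x) (f.base y) _ inf_le_left inf_le_right) := rfl

/-! ### Cocycles presented by a datum `(A, G)` along `ι : Y ⟶ X` -/

section Presented

variable (ι : Y ⟶ X) {S : Type v} (π : Y → S) (A : S → X.Opens) (G : ∀ a b : S, Γ(X, A a ⊓ A b))

/-- **A datum satisfying the cocycle identity modulo `ker ι^♯`, with `ι^♯(G_{aa})` units, presents a
cocycle on `Y`**: there is a cocycle with `U_y = ι⁻¹ A_{π y}` and `g_{yy'} = ι^♯(G_{π y, π y'})`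
(`g_{yy} = 1` because it is an idempotent unit). [folklore] -/
theorem exists_presented (mem : ∀ y, ι.base y ∈ A (π y))
    (hmul : ∀ (a b c : S) (i₁ : A a ⊓ A b ⊓ A c ≤ A a ⊓ A b) (i₂ : A a ⊓ A b ⊓ A c ≤ A b ⊓ A c)
      (i₃ : A a ⊓ A b ⊓ A c ≤ A a ⊓ A c),
      ι.app _ (secRes X i₁ (G a b) * secRes X i₂ (G b c)) = ι.app _ (secRes X i₃ (G a c)))
    (hunit : ∀ a : S, IsUnit (ι.app _ (G a a))) :
    ∃ (g : UnitCocycle Y) (hU : ∀ y, g.U y = ι ⁻¹ᵁ A (π y)),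
      ∀ (y y' : Y) (V : Y.Opens) (hy : V ≤ g.U y) (hy' : V ≤ g.U y'),
        g.g y y' V hy hy' = ι.appLE (A (π y) ⊓ A (π y')) V
          (le_preimage_inf ι (hy.trans_eq (hU y)) (hy'.trans_eq (hU y'))) (G (π y) (π y')) := by
  have gmul : ∀ (y y' y'' : Y) (V : Y.Opens) (hy : V ≤ ι ⁻¹ᵁ A (π y)) (hy' : V ≤ ι ⁻¹ᵁ A (π y'))
      (hy'' : V ≤ ι ⁻¹ᵁ A (π y'')),
      ι.appLE _ V (le_preimage_inf ι hy hy') (G (π y) (π y')) *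
        ι.appLE _ V (le_preimage_inf ι hy' hy'') (G (π y') (π y'')) =
        ι.appLE _ V (le_preimage_inf ι hy hy'') (G (π y) (π y'')) := by
    intro y y' y'' V hy hy' hy''
    have e₃ : V ≤ ι ⁻¹ᵁ (A (π y) ⊓ A (π y') ⊓ A (π y'')) :=
      le_preimage_inf ι (le_preimage_inf ι hy hy') hy''
    rw [← appLE_secRes ι (inf_le_left : A (π y) ⊓ A (π y') ⊓ A (π y'') ≤ _) e₃,
      ← appLE_secRes ι (le_inf (inf_le_left.trans inf_le_right) inf_le_right :
        A (π y) ⊓ A (π y') ⊓ A (π y'') ≤ A (π y') ⊓ A (π y'')) e₃,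
      ← appLE_secRes ι (le_inf (inf_le_left.trans inf_le_left) inf_le_right :
        A (π y) ⊓ A (π y') ⊓ A (π y'') ≤ A (π y) ⊓ A (π y'')) e₃, ← map_mul]
    exact appLE_eq_of_app_eq ι e₃ (hmul _ _ _ _ _ _)
  refine ⟨{ U := fun y => ι ⁻¹ᵁ A (π y)
            mem := mem
            g := fun y y' V hy hy' => ι.appLE _ V (le_preimage_inf ι hy hy') (G (π y) (π y'))
            map_g := fun y y' _ _ hy hy' i => secRes_appLE ι _ i _
            g_mul := gmul
            g_self := fun y V hy => ?_ }, fun _ => rfl, fun _ _ _ _ _ => rfl⟩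
  have hu : IsUnit (ι.appLE _ V (le_preimage_inf ι hy hy) (G (π y) (π y))) :=
    (hunit (π y)).map (Y.presheaf.map (homOfLE (le_preimage_inf ι hy hy)).op).hom
  exact hu.mul_right_inj.mp ((gmul y y y V hy hy hy).trans (mul_one _).symm)

variable {ι π A G}

/-- **The class of a presented cocycle**: a cocycle `g₀` whose transition functions over the opens
`ι⁻¹(A_{π y} ⊓ A_{π y'}) ⊆ U_y ⊓ U_{y'}` are `ι^♯(G_{π y, π y'})` has the same class as any cocycle
presented by the datum (refinement, Hartshorne III Ex. 4.4). [folklore] -/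
theorem _root_.Literature.AlgebraicGeometry.Modules.CechPic.mk_eq_mk_of_presented
    (mem : ∀ y, ι.base y ∈ A (π y)) {g₀ g : UnitCocycle Y} (hU : ∀ y, g.U y = ι ⁻¹ᵁ A (π y))
    (hg : ∀ (y y' : Y) (V : Y.Opens) (hy : V ≤ g.U y) (hy' : V ≤ g.U y'),
      g.g y y' V hy hy' = ι.appLE (A (π y) ⊓ A (π y')) V
        (le_preimage_inf ι (hy.trans_eq (hU y)) (hy'.trans_eq (hU y'))) (G (π y) (π y')))
    (hle : ∀ y, ι ⁻¹ᵁ A (π y) ≤ g₀.U y)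
    (hval : ∀ y y', g₀.g y y' (ι ⁻¹ᵁ (A (π y) ⊓ A (π y')))
      ((ι.preimage_mono inf_le_left).trans (hle y))
      ((ι.preimage_mono inf_le_right).trans (hle y')) = ι.app _ (G (π y) (π y'))) :
    CechPic.mk g₀ = CechPic.mk g := by
  refine CechPic.sound (equiv_of_eq g₀ g (fun y => ι ⁻¹ᵁ A (π y)) mem hle (fun y => (hU y).ge)
    fun y y' V hy hy' => ?_)
  rw [hg, ← g₀.map_g y y' ((ι.preimage_mono inf_le_left).trans (hle y))
    ((ι.preimage_mono inf_le_right).trans (hle y')) (le_preimage_inf ι hy hy'), hval,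
    Scheme.Hom.app_eq_appLE, secRes_appLE]

/-- Two data which agree under `ι^♯` on a refinement present the same class. [folklore] -/
theorem _root_.Literature.AlgebraicGeometry.Modules.CechPic.mk_eq_mk_of_presented_congr
    {g : UnitCocycle Y} (hU : ∀ y, g.U y = ι ⁻¹ᵁ A (π y))
    (hg : ∀ (y y' : Y) (V : Y.Opens) (hy : V ≤ g.U y) (hy' : V ≤ g.U y'),
      g.g y y' V hy hy' = ι.appLE (A (π y) ⊓ A (π y')) V
        (le_preimage_inf ι (hy.trans_eq (hU y)) (hy'.trans_eq (hU y'))) (G (π y) (π y')))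
    {A' : S → X.Opens} {G' : ∀ a b : S, Γ(X, A' a ⊓ A' b)} (mem' : ∀ y, ι.base y ∈ A' (π y))
    (hAA' : ∀ a, A' a ≤ A a) {g' : UnitCocycle Y} (hU' : ∀ y, g'.U y = ι ⁻¹ᵁ A' (π y))
    (hg' : ∀ (y y' : Y) (V : Y.Opens) (hy : V ≤ g'.U y) (hy' : V ≤ g'.U y'),
      g'.g y y' V hy hy' = ι.appLE (A' (π y) ⊓ A' (π y')) V
        (le_preimage_inf ι (hy.trans_eq (hU' y)) (hy'.trans_eq (hU' y'))) (G' (π y) (π y')))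
    (hGG' : ∀ (a b : S) (j : A' a ⊓ A' b ≤ A a ⊓ A b),
      ι.app _ (G' a b) = ι.app _ (secRes X j (G a b))) :
    CechPic.mk g = CechPic.mk g' := by
  refine CechPic.mk_eq_mk_of_presented mem' hU' hg'
    (fun y => (ι.preimage_mono (hAA' _)).trans (hU y).ge) fun y y' => ?_
  rw [hg, hGG' _ _ (inf_le_inf (hAA' _) (hAA' _)), Scheme.Hom.app_eq_appLE, appLE_secRes]

/-- The product of two data presents the product of the classes. [folklore] -/
theorem _root_.Literature.AlgebraicGeometry.Modules.CechPic.mk_presented_mul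
    (mem : ∀ y, ι.base y ∈ A (π y)) {G₁ G₂ : ∀ a b : S, Γ(X, A a ⊓ A b)}
    {g₁ g₂ g₃ : UnitCocycle Y} (hU₁ : ∀ y, g₁.U y = ι ⁻¹ᵁ A (π y))
    (hg₁ : ∀ (y y' : Y) (V : Y.Opens) (hy : V ≤ g₁.U y) (hy' : V ≤ g₁.U y'),
      g₁.g y y' V hy hy' = ι.appLE (A (π y) ⊓ A (π y')) V
        (le_preimage_inf ι (hy.trans_eq (hU₁ y)) (hy'.trans_eq (hU₁ y'))) (G₁ (π y) (π y')))
    (hU₂ : ∀ y, g₂.U y = ι ⁻¹ᵁ A (π y))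
    (hg₂ : ∀ (y y' : Y) (V : Y.Opens) (hy : V ≤ g₂.U y) (hy' : V ≤ g₂.U y'),
      g₂.g y y' V hy hy' = ι.appLE (A (π y) ⊓ A (π y')) V
        (le_preimage_inf ι (hy.trans_eq (hU₂ y)) (hy'.trans_eq (hU₂ y'))) (G₂ (π y) (π y')))
    (hU₃ : ∀ y, g₃.U y = ι ⁻¹ᵁ A (π y))
    (hg₃ : ∀ (y y' : Y) (V : Y.Opens) (hy : V ≤ g₃.U y) (hy' : V ≤ g₃.U y'),
      g₃.g y y' V hy hy' = ι.appLE (A (π y) ⊓ A (π y')) V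
        (le_preimage_inf ι (hy.trans_eq (hU₃ y)) (hy'.trans_eq (hU₃ y')))
        (G₁ (π y) (π y') * G₂ (π y) (π y'))) :
    CechPic.mk g₃ = CechPic.mk g₁ * CechPic.mk g₂ := by
  rw [← CechPic.mk_mul]
  refine CechPic.sound (equiv_of_eq _ _ (fun y => ι ⁻¹ᵁ A (π y)) mem (fun y => (hU₃ y).ge)
    (fun y => le_inf (hU₁ y).ge (hU₂ y).ge) fun y y' V hy hy' => ?_)
  change g₁.g y y' V _ _ * g₂.g y y' V _ _ = g₃.g y y' V _ _
  rw [hg₁, hg₂, hg₃, map_mul]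

/-- The cocycle identity under `ι^♯` passes to powers of the datum. [folklore] -/
theorem app_pow_mul_pow
    (hmul : ∀ (a b c : S) (i₁ : A a ⊓ A b ⊓ A c ≤ A a ⊓ A b) (i₂ : A a ⊓ A b ⊓ A c ≤ A b ⊓ A c)
      (i₃ : A a ⊓ A b ⊓ A c ≤ A a ⊓ A c),
      ι.app _ (secRes X i₁ (G a b) * secRes X i₂ (G b c)) = ι.app _ (secRes X i₃ (G a c)))
    (K : ℕ) (a b c : S) (i₁ : A a ⊓ A b ⊓ A c ≤ A a ⊓ A b) (i₂ : A a ⊓ A b ⊓ A c ≤ A b ⊓ A c)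
    (i₃ : A a ⊓ A b ⊓ A c ≤ A a ⊓ A c) :
    ι.app _ (secRes X i₁ (G a b ^ K) * secRes X i₂ (G b c ^ K)) =
      ι.app _ (secRes X i₃ (G a c ^ K)) := by
  rw [map_pow, map_pow, ← mul_pow, map_pow, hmul a b c i₁ i₂ i₃, map_pow, map_pow]

/-- The `K`-th power of a datum (satisfying the hypotheses of `exists_presented`) presents the
`K`-th power of the class. [folklore] -/
theorem _root_.Literature.AlgebraicGeometry.Modules.CechPic.mk_presented_pow
    (mem : ∀ y, ι.base y ∈ A (π y))
    (hmul : ∀ (a b c : S) (i₁ : A a ⊓ A b ⊓ A c ≤ A a ⊓ A b) (i₂ : A a ⊓ A b ⊓ A c ≤ A b ⊓ A c)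
      (i₃ : A a ⊓ A b ⊓ A c ≤ A a ⊓ A c),
      ι.app _ (secRes X i₁ (G a b) * secRes X i₂ (G b c)) = ι.app _ (secRes X i₃ (G a c)))
    (hunit : ∀ a : S, IsUnit (ι.app _ (G a a)))
    {g : UnitCocycle Y} (hU : ∀ y, g.U y = ι ⁻¹ᵁ A (π y))
    (hg : ∀ (y y' : Y) (V : Y.Opens) (hy : V ≤ g.U y) (hy' : V ≤ g.U y'),
      g.g y y' V hy hy' = ι.appLE (A (π y) ⊓ A (π y')) V
        (le_preimage_inf ι (hy.trans_eq (hU y)) (hy'.trans_eq (hU y'))) (G (π y) (π y')))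
    (K : ℕ) {g' : UnitCocycle Y} (hU' : ∀ y, g'.U y = ι ⁻¹ᵁ A (π y))
    (hg' : ∀ (y y' : Y) (V : Y.Opens) (hy : V ≤ g'.U y) (hy' : V ≤ g'.U y'),
      g'.g y y' V hy hy' = ι.appLE (A (π y) ⊓ A (π y')) V
        (le_preimage_inf ι (hy.trans_eq (hU' y)) (hy'.trans_eq (hU' y'))) (G (π y) (π y') ^ K)) :
    CechPic.mk g' = CechPic.mk g ^ K := by
  induction K generalizing g' with
  | zero =>
    rw [pow_zero, ← CechPic.mk_one]
    refine CechPic.sound (equiv_of_eq _ _ (fun y => ι ⁻¹ᵁ A (π y)) mem (fun y => (hU' y).ge)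
      (fun _ => le_top) fun y y' V hy hy' => ?_)
    change (1 : Γ(Y, V)) = g'.g y y' V _ _
    rw [hg', pow_zero, map_one]
  | succ K ih =>
    obtain ⟨gK, hUK, hgK⟩ := exists_presented ι π A (fun a b => G a b ^ K) mem
      (app_pow_mul_pow hmul K) fun a => by rw [map_pow]; exact (hunit a).pow K
    rw [pow_succ, ← ih hUK hgK]
    exact CechPic.mk_presented_mul (G₁ := fun a b => G a b ^ K) (G₂ := G) mem hUK hgK hU hg hU'
      fun y y' V hy hy' => by rw [hg', pow_succ]

/-- **Powers of presented classes are presented by powers of the datum**: existence form of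
`mk_presented_pow`. [folklore] -/
theorem _root_.Literature.AlgebraicGeometry.Modules.CechPic.exists_presented_pow
    (mem : ∀ y, ι.base y ∈ A (π y))
    (hmul : ∀ (a b c : S) (i₁ : A a ⊓ A b ⊓ A c ≤ A a ⊓ A b) (i₂ : A a ⊓ A b ⊓ A c ≤ A b ⊓ A c)
      (i₃ : A a ⊓ A b ⊓ A c ≤ A a ⊓ A c),
      ι.app _ (secRes X i₁ (G a b) * secRes X i₂ (G b c)) = ι.app _ (secRes X i₃ (G a c)))
    (hunit : ∀ a : S, IsUnit (ι.app _ (G a a)))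
    {g : UnitCocycle Y} (hU : ∀ y, g.U y = ι ⁻¹ᵁ A (π y))
    (hg : ∀ (y y' : Y) (V : Y.Opens) (hy : V ≤ g.U y) (hy' : V ≤ g.U y'),
      g.g y y' V hy hy' = ι.appLE (A (π y) ⊓ A (π y')) V
        (le_preimage_inf ι (hy.trans_eq (hU y)) (hy'.trans_eq (hU y'))) (G (π y) (π y')))
    (K : ℕ) :
    ∃ (g' : UnitCocycle Y) (hU' : ∀ y, g'.U y = ι ⁻¹ᵁ A (π y)),
      (∀ (y y' : Y) (V : Y.Opens) (hy : V ≤ g'.U y) (hy' : V ≤ g'.U y'),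
        g'.g y y' V hy hy' = ι.appLE (A (π y) ⊓ A (π y')) V
          (le_preimage_inf ι (hy.trans_eq (hU' y)) (hy'.trans_eq (hU' y'))) (G (π y) (π y') ^ K)) ∧
      CechPic.mk g' = CechPic.mk g ^ K := by
  obtain ⟨g', hU', hg'⟩ := exists_presented ι π A (fun a b => G a b ^ K) mem
    (app_pow_mul_pow hmul K) fun a => by rw [map_pow]; exact (hunit a).pow K
  exact ⟨g', hU', hg', CechPic.mk_presented_pow mem hmul hunit hU hg K hU' hg'⟩

/-- **Pull-back of presented classes along a factorisation `ι = t ≫ ι'`**: if `g'` on `Y'` is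
presented by `(A, G)` along `ι'` and `g` on `Y` by the same datum along `ι` (with compatible
indexings), then `t^*[g'] = [g]`. [folklore] -/
theorem _root_.Literature.AlgebraicGeometry.Modules.CechPic.pullback_mk_presented
    (t : Y ⟶ Y') (ι' : Y' ⟶ X) (hι : ι = t ≫ ι') (π' : Y' → S) (hπ : ∀ y, π' (t.base y) = π y)
    (mem : ∀ y, ι.base y ∈ A (π y)) {g : UnitCocycle Y} (hU : ∀ y, g.U y = ι ⁻¹ᵁ A (π y))
    (hg : ∀ (y y' : Y) (V : Y.Opens) (hy : V ≤ g.U y) (hy' : V ≤ g.U y'),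
      g.g y y' V hy hy' = ι.appLE (A (π y) ⊓ A (π y')) V
        (le_preimage_inf ι (hy.trans_eq (hU y)) (hy'.trans_eq (hU y'))) (G (π y) (π y')))
    {g' : UnitCocycle Y'} (hU' : ∀ y, g'.U y = ι' ⁻¹ᵁ A (π' y))
    (hg' : ∀ (y y' : Y') (V : Y'.Opens) (hy : V ≤ g'.U y) (hy' : V ≤ g'.U y'),
      g'.g y y' V hy hy' = ι'.appLE (A (π' y) ⊓ A (π' y')) V
        (le_preimage_inf ι' (hy.trans_eq (hU' y)) (hy'.trans_eq (hU' y'))) (G (π' y) (π' y'))) :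
    CechPic.pullback t (CechPic.mk g') = CechPic.mk g := by
  subst hι
  rw [CechPic.pullback_mk]
  refine CechPic.sound (equiv_of_eq _ _ (fun y => (t ≫ ι') ⁻¹ᵁ A (π y)) mem (fun y => ?_)
    (fun y => (hU y).ge) fun y y' V hy hy' => ?_)
  · change (t ≫ ι') ⁻¹ᵁ A (π y) ≤ t ⁻¹ᵁ g'.U (t.base y)
    rw [hU', hπ]
    exact le_rfl
  · rw [hg, pullback_g, hg', appLE_appLE]
    exact appLE_congr_index (t ≫ ι') A G (hπ y).symm (hπ y').symm _ _

end Presented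

end UnitCocycle

namespace CechPic

/-- **Functoriality of the pull-back**: `(f ≫ g)^* = f^* ∘ g^*` on `Ȟ¹(-, 𝒪^×)`. [folklore] -/
theorem pullback_comp (f : X ⟶ Y) (g : Y ⟶ Z) (c : CechPic Z) :
    pullback (f ≫ g) c = pullback f (pullback g c) := by
  obtain ⟨c, rfl⟩ := mk_surjective c
  rw [pullback_mk, pullback_mk, pullback_mk]
  refine sound (UnitCocycle.equiv_of_eq _ _ (fun x => (f ≫ g) ⁻¹ᵁ c.U ((f ≫ g).base x))
    (fun x => c.mem _) (fun x => le_rfl) (fun x => le_rfl) fun x y V hx hy => ?_)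
  rw [UnitCocycle.pullback_g, UnitCocycle.pullback_g, UnitCocycle.pullback_g, appLE_appLE]
  rfl

/-- **Presentation of classes along an embedding** (Hartshorne III Ex. 4.4: refining to small affine
opens). Let `ι : Y ⟶ X` be a topological embedding which is surjective on sections over the affine
opens of `X`, and assume that intersections of affine opens of `X` are affine; let `π : Y → S` be a
bijection (inverse `σ`). Then every class in `Ȟ¹(Y, 𝒪_Y^×)` is presented along `ι` by a datum
`(A, G)` with all `A_a` affine, and there are sections `H_{ab}` with `ι^♯(G_{ab} H_{ab}) = 1`;
moreover the datum satisfies the cocycle identity under `ι^♯`. [folklore] -/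
theorem exists_presentation (ι : Y ⟶ X) (hιe : Topology.IsInducing ι.base)
    (hsurj : ∀ U : X.Opens, IsAffineOpen U → Function.Surjective (ι.app U))
    (hinf : ∀ U V : X.Opens, IsAffineOpen U → IsAffineOpen V → IsAffineOpen (U ⊓ V))
    {S : Type v} (π : Y → S) (σ : S → Y) (hσπ : ∀ y, σ (π y) = y) (c : CechPic Y) :
    ∃ (A : S → X.Opens) (_ : ∀ a, IsAffineOpen (A a)) (_ : ∀ y, ι.base y ∈ A (π y))
      (G H : ∀ a b : S, Γ(X, A a ⊓ A b)) (g : UnitCocycle Y) (hU : ∀ y, g.U y = ι ⁻¹ᵁ A (π y)),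
      (∀ (y y' : Y) (V : Y.Opens) (hy : V ≤ g.U y) (hy' : V ≤ g.U y'),
        g.g y y' V hy hy' = ι.appLE (A (π y) ⊓ A (π y')) V
          (UnitCocycle.le_preimage_inf ι (hy.trans_eq (hU y)) (hy'.trans_eq (hU y')))
          (G (π y) (π y'))) ∧
      (∀ (a b c : S) (i₁ : A a ⊓ A b ⊓ A c ≤ A a ⊓ A b) (i₂ : A a ⊓ A b ⊓ A c ≤ A b ⊓ A c)
        (i₃ : A a ⊓ A b ⊓ A c ≤ A a ⊓ A c),
        ι.app _ (secRes X i₁ (G a b) * secRes X i₂ (G b c)) = ι.app _ (secRes X i₃ (G a c))) ∧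
      (∀ a b, ι.app _ (G a b * H a b) = 1) ∧ mk g = c := by
  obtain ⟨g₀, rfl⟩ := mk_surjective c
  -- affine opens `A a ∋ ι (σ a)` of `X` with `ι⁻¹ (A a) ≤ U_{σ a}`
  have href : ∀ a : S, ∃ A : X.Opens, IsAffineOpen A ∧ ι.base (σ a) ∈ A ∧
      ι ⁻¹ᵁ A ≤ g₀.U (σ a) := by
    intro a
    obtain ⟨O, hO, hOU⟩ := hιe.isOpen_iff.mp (g₀.U (σ a)).isOpen
    have hmemO : ι.base (σ a) ∈ (⟨O, hO⟩ : X.Opens) := by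
      change ι.base (σ a) ∈ O
      rw [← Set.mem_preimage, hOU]
      exact g₀.mem (σ a)
    obtain ⟨A, hA, hxA, hAO⟩ := Opens.isBasis_iff_nbhd.mp X.isBasis_affineOpens hmemO
    refine ⟨A, hA, hxA, fun y hy => ?_⟩
    have h : y ∈ ι.base ⁻¹' O := hAO hy
    rwa [hOU] at h
  choose A hA hmemσ hAU using href
  have mem : ∀ y, ι.base y ∈ A (π y) := fun y => by simpa only [hσπ] using hmemσ (π y)
  have hle : ∀ y, ι ⁻¹ᵁ A (π y) ≤ g₀.U y := fun y => by simpa only [hσπ] using hAU (π y)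
  -- lifts of the transition functions and of their inverses over `A a ⊓ A b`
  have hV : ∀ a b, ι ⁻¹ᵁ (A a ⊓ A b) ≤ g₀.U (σ a) := fun a b =>
    (ι.preimage_mono inf_le_left).trans (hAU a)
  have hV' : ∀ a b, ι ⁻¹ᵁ (A a ⊓ A b) ≤ g₀.U (σ b) := fun a b =>
    (ι.preimage_mono inf_le_right).trans (hAU b)
  choose G hG using fun a b =>
    hsurj _ (hinf _ _ (hA a) (hA b)) (g₀.g (σ a) (σ b) _ (hV a b) (hV' a b))
  choose H hH using fun a b =>
    hsurj _ (hinf _ _ (hA a) (hA b)) (g₀.g (σ b) (σ a) _ (hV' a b) (hV a b))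
  have hmul : ∀ (a b c : S) (i₁ : A a ⊓ A b ⊓ A c ≤ A a ⊓ A b)
      (i₂ : A a ⊓ A b ⊓ A c ≤ A b ⊓ A c) (i₃ : A a ⊓ A b ⊓ A c ≤ A a ⊓ A c),
      ι.app _ (secRes X i₁ (G a b) * secRes X i₂ (G b c)) = ι.app _ (secRes X i₃ (G a c)) := by
    intro a b c i₁ i₂ i₃
    rw [map_mul, app_secRes ι i₁, app_secRes ι i₂, app_secRes ι i₃, hG, hG, hG, g₀.map_g,
      g₀.map_g, g₀.map_g]
    exact g₀.g_mul _ _ _ _ _ _ _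
  have hunit : ∀ a, IsUnit (ι.app _ (G a a)) := fun a => by
    rw [hG, g₀.g_self]
    exact isUnit_one
  obtain ⟨g, hU, hg⟩ := UnitCocycle.exists_presented ι π A G mem hmul hunit
  refine ⟨A, hA, mem, G, H, g, hU, hg, hmul, fun a b => ?_, ?_⟩
  · rw [map_mul, hG, hH, g₀.g_mul_symm]
  · refine (mk_eq_mk_of_presented mem hU hg hle fun y y' => ?_).symm
    rw [hG]
    exact g₀.g_congr (hσπ y).symm (hσπ y').symm _ _ _ _ _

end CechPic

end Literature.AlgebraicGeometry.Modules

end
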